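import Mathlib
import HarnessLib

/-!
# QUANT lane R8, front "FAR beyond trees", layer one — THE DEGREE-THREE GATE AT THE OBSERVER, XLII: box-certificate kernel I — trivariate polynomials of
# multidegree ≤ (2,2,2), integer-friendly tensor-Bernstein control values, and the box non-positivity criterion

builds on p205010 (kernel theorem, internal audit signed; external expert review pending)

Support file (`--supports stmt-CriticalPhenomena-4575`), seat `prim-quant-p1` (gen 31); memo
`run/shared/lean/prim/quant/prim-quant-p1-g31/FOR-LEAD-GATE3-BOXES.md`.  Pure algebra (Mathlib only); standard axioms; no sorries.
GENERATED by `work/lean/gen_boxpoly.py`.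

A polynomial `q` of degree ≤ 2 in each of three variables is stored as its coefficient tensor `q : Fin 3 → Fin 3 → Fin 3 → R`
(`BoxPoly.P2`).  For a box `[X₀/D, X₁/D] × [Y₀/D, Y₁/D] × [Z₀/D, Z₁/D]` (`D > 0`; integer data when `R = ℤ`) the 27 SCALED TENSOR-BERNSTEIN
CONTROL VALUES `BoxPoly.ctrl` are computed by three univariate passes (`tx ∘ ty ∘ tz`, each the homogenised blossom
`(a₀,a₁,a₂) ↦ (a₀D² + a₁X₀D + a₂X₀², 2a₀D² + a₁(X₀+X₁)D + 2a₂X₀X₁, a₀D² + a₁X₁D + a₂X₁²)`), using only `+` and `*` — so the same definitions run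
in the kernel over `ℤ` (`decide`) and are reasoned about over `ℝ`.  `BoxPoly.eval_nonpos_of_ctrl`: if all 27 control values are `≤ 0` then
`q ≤ 0` on the box.  Also: coefficientwise `add`/`smul`, the three monomial shifts (multiplication by a variable, with a no-overflow side
condition) and their `eval` lemmas, and `map` along a ring hom (`ℤ → ℝ` casts commute with everything).
[this work].
-/

namespace Summit.CriticalPhenomena.PercolationContinuityZ3.Theorems

namespace Quant

namespace BoxPoly

variable {R : Type*} [CommRing R]

/-- Coefficient tensors of trivariate polynomials of multidegree ≤ (2,2,2). -/
abbrev P2 (R : Type*) := Fin 3 → Fin 3 → Fin 3 → R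

/-- Evaluation `Σ q i j k · xⁱ yʲ zᵏ` (written out). -/
def eval (q : P2 R) (x y z : R) : R := q 0 0 0 + q 0 0 1 * (z) + q 0 0 2 * (z * z) + q 0 1 0 * (y) + q 0 1 1 * (y * z) + q 0 1 2 * (y * z * z) + q 0 2 0 * (y * y) + q 0 2 1 * (y * y * z) + q 0 2 2 * (y * y * z * z) + q 1 0 0 * (x) + q 1 0 1 * (x * z) + q 1 0 2 * (x * z * z) + q 1 1 0 * (x * y) + q 1 1 1 * (x * y * z) + q 1 1 2 * (x * y * z * z) + q 1 2 0 * (x * y * y) + q 1 2 1 * (x * y * y * z) + q 1 2 2 * (x * y * y * z * z) + q 2 0 0 * (x * x) + q 2 0 1 * (x * x * z) + q 2 0 2 * (x * x * z * z) + q 2 1 0 * (x * x * y) + q 2 1 1 * (x * x * y * z) + q 2 1 2 * (x * x * y * z * z) + q 2 2 0 * (x * x * y * y) + q 2 2 1 * (x * x * y * y * z) + q 2 2 2 * (x * x * y * y * z * z)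

/-- Coefficientwise sum. -/
def add (q q' : P2 R) : P2 R := fun i j k => q i j k + q' i j k

/-- Coefficientwise scalar multiple. -/
def smul (c : R) (q : P2 R) : P2 R := fun i j k => c * q i j k

/-- The zero tensor. -/
def zero : P2 R := fun _ _ _ => 0

/-- Evaluation is additive. [this work] -/
theorem eval_add (q q' : P2 R) (x y z : R) : eval (add q q') x y z = eval q x y z + eval q' x y z := by
  simp only [eval, add]; ring

/-- Evaluation commutes with scalar multiplication. [this work] -/
theorem eval_smul (c : R) (q : P2 R) (x y z : R) : eval (smul c q) x y z = c * eval q x y z := by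
  simp only [eval, smul]; ring

/-- The zero tensor evaluates to `0`. [this work] -/
theorem eval_zero (x y z : R) : eval (zero : P2 R) x y z = 0 := by
  simp only [eval, zero]; ring

/-- Multiplication by the first variable (drops the degree-2 slice, which must vanish: `fitsX`). -/
def shiftX (q : P2 R) : P2 R := fun i j k => match i with | 0 => 0 | 1 => q 0 j k | 2 => q 1 j k
/-- Multiplication by the second variable. -/
def shiftY (q : P2 R) : P2 R := fun i j k => match j with | 0 => 0 | 1 => q i 0 k | 2 => q i 1 k
/-- Multiplication by the third variable. -/
def shiftZ (q : P2 R) : P2 R := fun i j k => match k with | 0 => 0 | 1 => q i j 0 | 2 => q i j 1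

/-- `shiftX` multiplies by the first variable (no overflow). [this work] -/
theorem eval_shiftX (q : P2 R) (h : ∀ j k : Fin 3, q 2 j k = 0) (x y z : R) : eval (shiftX q) x y z = x * eval q x y z := by
  have h00 := h 0 0; have h01 := h 0 1; have h02 := h 0 2; have h10 := h 1 0; have h11 := h 1 1; have h12 := h 1 2
  have h20 := h 2 0; have h21 := h 2 1; have h22 := h 2 2
  simp only [eval, shiftX]
  rw [h00, h01, h02, h10, h11, h12, h20, h21, h22]
  ring

/-- `shiftY` multiplies by the second variable (no overflow). [this work] -/
theorem eval_shiftY (q : P2 R) (h : ∀ i k : Fin 3, q i 2 k = 0) (x y z : R) : eval (shiftY q) x y z = y * eval q x y z := by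
  have h00 := h 0 0; have h01 := h 0 1; have h02 := h 0 2; have h10 := h 1 0; have h11 := h 1 1; have h12 := h 1 2
  have h20 := h 2 0; have h21 := h 2 1; have h22 := h 2 2
  simp only [eval, shiftY]
  rw [h00, h01, h02, h10, h11, h12, h20, h21, h22]
  ring

/-- `shiftZ` multiplies by the third variable (no overflow). [this work] -/
theorem eval_shiftZ (q : P2 R) (h : ∀ i j : Fin 3, q i j 2 = 0) (x y z : R) : eval (shiftZ q) x y z = z * eval q x y z := by
  have h00 := h 0 0; have h01 := h 0 1; have h02 := h 0 2; have h10 := h 1 0; have h11 := h 1 1; have h12 := h 1 2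
  have h20 := h 2 0; have h21 := h 2 1; have h22 := h 2 2
  simp only [eval, shiftZ]
  rw [h00, h01, h02, h10, h11, h12, h20, h21, h22]
  ring

/-! ## Homogenised univariate Bernstein (blossom) control values -/

/-- Scaled control value `D²·c₀` of `a₀ + a₁ t + a₂ t²` on `[X₀/D, X₁/D]`. -/
def c0 (X0 D a0 a1 a2 : R) : R := a0 * D * D + a1 * X0 * D + a2 * X0 * X0
/-- Scaled control value `2D²·c₁`. -/
def c1 (X0 X1 D a0 a1 a2 : R) : R := 2 * a0 * D * D + a1 * (X0 + X1) * D + 2 * a2 * X0 * X1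
/-- Scaled control value `D²·c₂`. -/
def c2 (X1 D a0 a1 a2 : R) : R := a0 * D * D + a1 * X1 * D + a2 * X1 * X1

/-- Univariate criterion: the three scaled control values `≤ 0` force `a₀ + a₁t + a₂t² ≤ 0` on `X₀ ≤ D t ≤ X₁` (`D > 0`). -/
theorem quad_nonpos {K : Type*} [Field K] [LinearOrder K] [IsStrictOrderedRing K]
    (X0 X1 D a0 a1 a2 t : K) (hD : 0 < D) (h0 : X0 ≤ D * t) (h1 : D * t ≤ X1)
    (hc0 : c0 X0 D a0 a1 a2 ≤ 0) (hc1 : c1 X0 X1 D a0 a1 a2 ≤ 0) (hc2 : c2 X1 D a0 a1 a2 ≤ 0) :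
    a0 + a1 * t + a2 * (t * t) ≤ 0 := by
  simp only [c0, c1, c2] at hc0 hc1 hc2
  have key : (X1 - X0) * (X1 - X0) * (D * D * (a0 + a1 * t + a2 * (t * t))) =
      (a0 * D * D + a1 * X0 * D + a2 * X0 * X0) * ((X1 - D * t) * (X1 - D * t)) +
      (2 * a0 * D * D + a1 * (X0 + X1) * D + 2 * a2 * X0 * X1) * ((D * t - X0) * (X1 - D * t)) +
      (a0 * D * D + a1 * X1 * D + a2 * X1 * X1) * ((D * t - X0) * (D * t - X0)) := by ring
  have u0 : 0 ≤ (X1 - D * t) * (X1 - D * t) := mul_self_nonneg _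
  have u1 : 0 ≤ (D * t - X0) * (X1 - D * t) := mul_nonneg (by linarith) (by linarith)
  have u2 : 0 ≤ (D * t - X0) * (D * t - X0) := mul_self_nonneg _
  have hrhs : (X1 - X0) * (X1 - X0) * (D * D * (a0 + a1 * t + a2 * (t * t))) ≤ 0 := by
    rw [key]
    have v0 := mul_nonpos_of_nonpos_of_nonneg hc0 u0
    have v1 := mul_nonpos_of_nonpos_of_nonneg hc1 u1
    have v2 := mul_nonpos_of_nonpos_of_nonneg hc2 u2
    linarith
  have hDD : 0 < D * D := mul_pos hD hD
  rcases lt_or_eq_of_le (show X0 ≤ X1 by linarith) with hlt | heq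
  · have hsq : 0 < (X1 - X0) * (X1 - X0) := mul_pos (by linarith) (by linarith)
    have hq : D * D * (a0 + a1 * t + a2 * (t * t)) ≤ 0 := by
      by_contra hh
      push Not at hh
      have := mul_pos hsq hh
      linarith
    by_contra hh
    push Not at hh
    have := mul_pos hDD hh
    linarith
  · have ht : D * t = X0 := le_antisymm (by rw [heq]; exact h1) h0
    have e : D * D * (a0 + a1 * t + a2 * (t * t)) = a0 * D * D + a1 * X0 * D + a2 * X0 * X0 := by rw [← ht]; ring
    by_contra hh
    push Not at hh
    have := mul_pos hDD hh
    linarith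

/-! ## Tensor control values -/

/-- Univariate pass along the third variable. -/
def tz (Z0 Z1 D : R) (q : P2 R) : P2 R := fun i j k =>
  match k with
  | 0 => c0 Z0 D (q i j 0) (q i j 1) (q i j 2)
  | 1 => c1 Z0 Z1 D (q i j 0) (q i j 1) (q i j 2)
  | 2 => c2 Z1 D (q i j 0) (q i j 1) (q i j 2)
/-- Univariate pass along the second variable. -/
def ty (Y0 Y1 D : R) (q : P2 R) : P2 R := fun i j k =>
  match j with
  | 0 => c0 Y0 D (q i 0 k) (q i 1 k) (q i 2 k)
  | 1 => c1 Y0 Y1 D (q i 0 k) (q i 1 k) (q i 2 k)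
  | 2 => c2 Y1 D (q i 0 k) (q i 1 k) (q i 2 k)
/-- Univariate pass along the first variable. -/
def tx (X0 X1 D : R) (q : P2 R) : P2 R := fun i j k =>
  match i with
  | 0 => c0 X0 D (q 0 j k) (q 1 j k) (q 2 j k)
  | 1 => c1 X0 X1 D (q 0 j k) (q 1 j k) (q 2 j k)
  | 2 => c2 X1 D (q 0 j k) (q 1 j k) (q 2 j k)

/-- The 27 scaled tensor-Bernstein control values of `q` on the box `[X₀/D,X₁/D]×[Y₀/D,Y₁/D]×[Z₀/D,Z₁/D]`. -/
def ctrl (X0 X1 Y0 Y1 Z0 Z1 D : R) (q : P2 R) : P2 R := tx X0 X1 D (ty Y0 Y1 D (tz Z0 Z1 D q))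

/-- Bivariate evaluation of a slice. -/
def eval2 (s : Fin 3 → Fin 3 → R) (x y : R) : R := s 0 0 + s 0 1 * (y) + s 0 2 * (y * y) + s 1 0 * (x) + s 1 1 * (x * y) + s 1 2 * (x * y * y) + s 2 0 * (x * x) + s 2 1 * (x * x * y) + s 2 2 * (x * x * y * y)

/-- Univariate evaluation of a slice. -/
def eval1 (s : Fin 3 → R) (x : R) : R := s 0 + s 1 * (x) + s 2 * (x * x)

/-- Evaluation as a quadratic in the third variable with bivariate slice coefficients. [this work] -/
theorem eval_eq_eval2 (q : P2 R) (x y z : R) :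
    eval q x y z = eval2 (fun i j => q i j 0) x y + eval2 (fun i j => q i j 1) x y * z + eval2 (fun i j => q i j 2) x y * (z * z) := by
  simp only [eval, eval2]; ring

/-- Bivariate evaluation as a quadratic in the second variable. [this work] -/
theorem eval2_eq_eval1 (s : Fin 3 → Fin 3 → R) (x y : R) :
    eval2 s x y = eval1 (fun i => s i 0) x + eval1 (fun i => s i 1) x * y + eval1 (fun i => s i 2) x * (y * y) := by
  simp only [eval2, eval1]; ring

/-- The z-pass computes the scaled control value `c0` slice-wise. [this work] -/
theorem eval2_tz0 (Z0 Z1 D : R) (q : P2 R) (x y : R) :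
    eval2 (fun i j => tz Z0 Z1 D q i j 0) x y = c0 Z0 D (eval2 (fun i j => q i j 0) x y) (eval2 (fun i j => q i j 1) x y) (eval2 (fun i j => q i j 2) x y) := by
  simp only [eval2, tz, c0]; ring
/-- The z-pass computes the scaled control value `c1` slice-wise. [this work] -/
theorem eval2_tz1 (Z0 Z1 D : R) (q : P2 R) (x y : R) :
    eval2 (fun i j => tz Z0 Z1 D q i j 1) x y = c1 Z0 Z1 D (eval2 (fun i j => q i j 0) x y) (eval2 (fun i j => q i j 1) x y) (eval2 (fun i j => q i j 2) x y) := by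
  simp only [eval2, tz, c1]; ring
/-- The z-pass computes the scaled control value `c2` slice-wise. [this work] -/
theorem eval2_tz2 (Z0 Z1 D : R) (q : P2 R) (x y : R) :
    eval2 (fun i j => tz Z0 Z1 D q i j 2) x y = c2 Z1 D (eval2 (fun i j => q i j 0) x y) (eval2 (fun i j => q i j 1) x y) (eval2 (fun i j => q i j 2) x y) := by
  simp only [eval2, tz, c2]; ring

/-- The y-pass computes `c0` slice-wise. [this work] -/
theorem eval1_ty0 (Y0 D : R) (s : Fin 3 → Fin 3 → R) (x : R) :
    eval1 (fun i => c0 Y0 D (s i 0) (s i 1) (s i 2)) x = c0 Y0 D (eval1 (fun i => s i 0) x) (eval1 (fun i => s i 1) x) (eval1 (fun i => s i 2) x) := by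
  simp only [eval1, c0]; ring
/-- The y-pass computes `c1` slice-wise. [this work] -/
theorem eval1_ty1 (Y0 Y1 D : R) (s : Fin 3 → Fin 3 → R) (x : R) :
    eval1 (fun i => c1 Y0 Y1 D (s i 0) (s i 1) (s i 2)) x = c1 Y0 Y1 D (eval1 (fun i => s i 0) x) (eval1 (fun i => s i 1) x) (eval1 (fun i => s i 2) x) := by
  simp only [eval1, c1]; ring
/-- The y-pass computes `c2` slice-wise. [this work] -/
theorem eval1_ty2 (Y1 D : R) (s : Fin 3 → Fin 3 → R) (x : R) :
    eval1 (fun i => c2 Y1 D (s i 0) (s i 1) (s i 2)) x = c2 Y1 D (eval1 (fun i => s i 0) x) (eval1 (fun i => s i 1) x) (eval1 (fun i => s i 2) x) := by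
  simp only [eval1, c2]; ring

section Ordered

variable {K : Type*} [Field K] [LinearOrder K] [IsStrictOrderedRing K]

/-- Univariate criterion for a slice given by coefficients `s 0, s 1, s 2`. -/
theorem eval1_nonpos (X0 X1 D : K) (s : Fin 3 → K) (x : K) (hD : 0 < D) (h0 : X0 ≤ D * x) (h1 : D * x ≤ X1)
    (hc0 : c0 X0 D (s 0) (s 1) (s 2) ≤ 0) (hc1 : c1 X0 X1 D (s 0) (s 1) (s 2) ≤ 0) (hc2 : c2 X1 D (s 0) (s 1) (s 2) ≤ 0) :
    eval1 s x ≤ 0 := by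
  have := quad_nonpos X0 X1 D (s 0) (s 1) (s 2) x hD h0 h1 hc0 hc1 hc2
  simpa only [eval1] using this

/-- Bivariate criterion: the 9 scaled tensor control values (y-pass then x-pass) are `≤ 0`. -/
theorem eval2_nonpos (X0 X1 Y0 Y1 D : K) (s : Fin 3 → Fin 3 → K) (x y : K) (hD : 0 < D)
    (hx0 : X0 ≤ D * x) (hx1 : D * x ≤ X1) (hy0 : Y0 ≤ D * y) (hy1 : D * y ≤ Y1)
    (h : ∀ i j : Fin 3, tx X0 X1 D (ty Y0 Y1 D (fun i' j' (_ : Fin 3) => s i' j')) i j 0 ≤ 0) :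
    eval2 s x y ≤ 0 := by
  rw [eval2_eq_eval1]
  apply quad_nonpos Y0 Y1 D _ _ _ y hD hy0 hy1
  · rw [← eval1_ty0 Y0 D s x]
    apply eval1_nonpos X0 X1 D _ x hD hx0 hx1
    · simpa only [tx, ty] using h 0 0
    · simpa only [tx, ty] using h 1 0
    · simpa only [tx, ty] using h 2 0
  · rw [← eval1_ty1 Y0 Y1 D s x]
    apply eval1_nonpos X0 X1 D _ x hD hx0 hx1
    · simpa only [tx, ty] using h 0 1
    · simpa only [tx, ty] using h 1 1
    · simpa only [tx, ty] using h 2 1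
  · rw [← eval1_ty2 Y1 D s x]
    apply eval1_nonpos X0 X1 D _ x hD hx0 hx1
    · simpa only [tx, ty] using h 0 2
    · simpa only [tx, ty] using h 1 2
    · simpa only [tx, ty] using h 2 2

/-- **Box criterion.** If the 27 scaled tensor-Bernstein control values of `q` on the box are `≤ 0`, then `q ≤ 0` on the box. -/
theorem eval_nonpos_of_ctrl (X0 X1 Y0 Y1 Z0 Z1 D : K) (q : P2 K) (x y z : K) (hD : 0 < D)
    (hx0 : X0 ≤ D * x) (hx1 : D * x ≤ X1) (hy0 : Y0 ≤ D * y) (hy1 : D * y ≤ Y1) (hz0 : Z0 ≤ D * z) (hz1 : D * z ≤ Z1)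
    (h : ∀ i j k : Fin 3, ctrl X0 X1 Y0 Y1 Z0 Z1 D q i j k ≤ 0) : eval q x y z ≤ 0 := by
  rw [eval_eq_eval2]
  apply quad_nonpos Z0 Z1 D _ _ _ z hD hz0 hz1
  · rw [← eval2_tz0 Z0 Z1 D q x y]
    apply eval2_nonpos X0 X1 Y0 Y1 D _ x y hD hx0 hx1 hy0 hy1
    intro i j
    simpa only [ctrl, tx, ty, tz] using h i j 0
  · rw [← eval2_tz1 Z0 Z1 D q x y]
    apply eval2_nonpos X0 X1 Y0 Y1 D _ x y hD hx0 hx1 hy0 hy1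
    intro i j
    simpa only [ctrl, tx, ty, tz] using h i j 1
  · rw [← eval2_tz2 Z0 Z1 D q x y]
    apply eval2_nonpos X0 X1 Y0 Y1 D _ x y hD hx0 hx1 hy0 hy1
    intro i j
    simpa only [ctrl, tx, ty, tz] using h i j 2

end Ordered

/-! ## Change of scalars (`ℤ → ℝ`) -/

/-- Apply a ring hom coefficientwise. -/
def map {S : Type*} [CommRing S] (f : R →+* S) (q : P2 R) : P2 S := fun i j k => f (q i j k)

/-- `map` commutes with `add`. [this work] -/
theorem map_add {S : Type*} [CommRing S] (f : R →+* S) (q q' : P2 R) : map f (add q q') = add (map f q) (map f q') := by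
  funext i j k; simp [map, add]

/-- `map` commutes with `smul`. [this work] -/
theorem map_smul {S : Type*} [CommRing S] (f : R →+* S) (c : R) (q : P2 R) : map f (smul c q) = smul (f c) (map f q) := by
  funext i j k; simp [map, smul]

/-- `map` of the zero tensor. [this work] -/
theorem map_zero {S : Type*} [CommRing S] (f : R →+* S) : map f (zero : P2 R) = zero := by
  funext i j k; simp [map, zero]

/-- `map` commutes with `shiftX`. [this work] -/
theorem map_shiftX {S : Type*} [CommRing S] (f : R →+* S) (q : P2 R) : map f (shiftX q) = shiftX (map f q) := by
  funext i j k; fin_cases i <;> simp [map, shiftX]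
/-- `map` commutes with `shiftY`. [this work] -/
theorem map_shiftY {S : Type*} [CommRing S] (f : R →+* S) (q : P2 R) : map f (shiftY q) = shiftY (map f q) := by
  funext i j k; fin_cases j <;> simp [map, shiftY]
/-- `map` commutes with `shiftZ`. [this work] -/
theorem map_shiftZ {S : Type*} [CommRing S] (f : R →+* S) (q : P2 R) : map f (shiftZ q) = shiftZ (map f q) := by
  funext i j k; fin_cases k <;> simp [map, shiftZ]

/-- A ring hom commutes with `c0`. [this work] -/
theorem map_c0 {S : Type*} [CommRing S] (f : R →+* S) (X0 D a0 a1 a2 : R) :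
    f (c0 X0 D a0 a1 a2) = c0 (f X0) (f D) (f a0) (f a1) (f a2) := by
  simp only [c0, _root_.map_add, _root_.map_mul]
/-- A ring hom commutes with `c1`. [this work] -/
theorem map_c1 {S : Type*} [CommRing S] (f : R →+* S) (X0 X1 D a0 a1 a2 : R) :
    f (c1 X0 X1 D a0 a1 a2) = c1 (f X0) (f X1) (f D) (f a0) (f a1) (f a2) := by
  simp only [c1, _root_.map_add, _root_.map_mul, map_ofNat]
/-- A ring hom commutes with `c2`. [this work] -/
theorem map_c2 {S : Type*} [CommRing S] (f : R →+* S) (X1 D a0 a1 a2 : R) :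
    f (c2 X1 D a0 a1 a2) = c2 (f X1) (f D) (f a0) (f a1) (f a2) := by
  simp only [c2, _root_.map_add, _root_.map_mul]

/-- `map` commutes with the z-pass. [this work] -/
theorem map_tz {S : Type*} [CommRing S] (f : R →+* S) (Z0 Z1 D : R) (q : P2 R) :
    map f (tz Z0 Z1 D q) = tz (f Z0) (f Z1) (f D) (map f q) := by
  funext i j k
  fin_cases k
  · show f (c0 Z0 D (q i j 0) (q i j 1) (q i j 2)) = c0 (f Z0) (f D) (f (q i j 0)) (f (q i j 1)) (f (q i j 2)); exact map_c0 f _ _ _ _ _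
  · show f (c1 Z0 Z1 D (q i j 0) (q i j 1) (q i j 2)) = c1 (f Z0) (f Z1) (f D) (f (q i j 0)) (f (q i j 1)) (f (q i j 2)); exact map_c1 f _ _ _ _ _ _
  · show f (c2 Z1 D (q i j 0) (q i j 1) (q i j 2)) = c2 (f Z1) (f D) (f (q i j 0)) (f (q i j 1)) (f (q i j 2)); exact map_c2 f _ _ _ _ _
/-- `map` commutes with the y-pass. [this work] -/
theorem map_ty {S : Type*} [CommRing S] (f : R →+* S) (Y0 Y1 D : R) (q : P2 R) :
    map f (ty Y0 Y1 D q) = ty (f Y0) (f Y1) (f D) (map f q) := by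
  funext i j k
  fin_cases j
  · show f (c0 Y0 D (q i 0 k) (q i 1 k) (q i 2 k)) = c0 (f Y0) (f D) (f (q i 0 k)) (f (q i 1 k)) (f (q i 2 k)); exact map_c0 f _ _ _ _ _
  · show f (c1 Y0 Y1 D (q i 0 k) (q i 1 k) (q i 2 k)) = c1 (f Y0) (f Y1) (f D) (f (q i 0 k)) (f (q i 1 k)) (f (q i 2 k)); exact map_c1 f _ _ _ _ _ _
  · show f (c2 Y1 D (q i 0 k) (q i 1 k) (q i 2 k)) = c2 (f Y1) (f D) (f (q i 0 k)) (f (q i 1 k)) (f (q i 2 k)); exact map_c2 f _ _ _ _ _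
/-- `map` commutes with the x-pass. [this work] -/
theorem map_tx {S : Type*} [CommRing S] (f : R →+* S) (X0 X1 D : R) (q : P2 R) :
    map f (tx X0 X1 D q) = tx (f X0) (f X1) (f D) (map f q) := by
  funext i j k
  fin_cases i
  · show f (c0 X0 D (q 0 j k) (q 1 j k) (q 2 j k)) = c0 (f X0) (f D) (f (q 0 j k)) (f (q 1 j k)) (f (q 2 j k)); exact map_c0 f _ _ _ _ _
  · show f (c1 X0 X1 D (q 0 j k) (q 1 j k) (q 2 j k)) = c1 (f X0) (f X1) (f D) (f (q 0 j k)) (f (q 1 j k)) (f (q 2 j k)); exact map_c1 f _ _ _ _ _ _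
  · show f (c2 X1 D (q 0 j k) (q 1 j k) (q 2 j k)) = c2 (f X1) (f D) (f (q 0 j k)) (f (q 1 j k)) (f (q 2 j k)); exact map_c2 f _ _ _ _ _

/-- `map` commutes with the control-value transform. [this work] -/
theorem map_ctrl {S : Type*} [CommRing S] (f : R →+* S) (X0 X1 Y0 Y1 Z0 Z1 D : R) (q : P2 R) :
    map f (ctrl X0 X1 Y0 Y1 Z0 Z1 D q) = ctrl (f X0) (f X1) (f Y0) (f Y1) (f Z0) (f Z1) (f D) (map f q) := by
  simp only [ctrl, map_tx, map_ty, map_tz]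

/-- Evaluation commutes with a ring hom. [this work] -/
theorem eval_map {S : Type*} [CommRing S] (f : R →+* S) (q : P2 R) (x y z : R) :
    eval (map f q) (f x) (f y) (f z) = f (eval q x y z) := by
  simp only [eval, map, _root_.map_add, _root_.map_mul]

/-- Vanishing of the top x-slice is preserved by `map`. [this work] -/
theorem fitsX_map {S : Type*} [CommRing S] (f : R →+* S) (q : P2 R) (h : ∀ j k : Fin 3, q 2 j k = 0) : ∀ j k : Fin 3, map f q 2 j k = 0 := by
  intro j k; simp [map, h j k]
/-- Vanishing of the top y-slice is preserved by `map`. [this work] -/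
theorem fitsY_map {S : Type*} [CommRing S] (f : R →+* S) (q : P2 R) (h : ∀ i k : Fin 3, q i 2 k = 0) : ∀ i k : Fin 3, map f q i 2 k = 0 := by
  intro i k; simp [map, h i k]
/-- Vanishing of the top z-slice is preserved by `map`. [this work] -/
theorem fitsZ_map {S : Type*} [CommRing S] (f : R →+* S) (q : P2 R) (h : ∀ i j : Fin 3, q i j 2 = 0) : ∀ i j : Fin 3, map f q i j 2 = 0 := by
  intro i j; simp [map, h i j]

/-- Integer entries `≤ 0` give real entries `≤ 0` after casting. -/
theorem nonpos_map_int (q : P2 ℤ) (h : ∀ i j k : Fin 3, q i j k ≤ 0) : ∀ i j k : Fin 3, map (Int.castRingHom ℝ) q i j k ≤ 0 := by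
  intro i j k
  have := h i j k
  simp only [map, eq_intCast]
  exact_mod_cast this

end BoxPoly

end Quant

end Summit.CriticalPhenomena.PercolationContinuityZ3.Theorems
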